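import Summits.CriticalPhenomena.SAWScalingLimit.Theorems.SAWRenewalTightnessSubseqIdentificationCompensatorMassLowerBound
import Mathlib.Analysis.SpecialFunctions.Pow.Deriv
import Mathlib.Analysis.SpecialFunctions.Integrals.Basic
import HarnessLib

/-!
# Divergence of the compensator along the vertical slit (line `boundary-area-law`, RS5c, L3)

Line `boundary-area-law` of the crux `SubseqIdentification` (stmt-CriticalPhenomena-0783),
restriction reshape (lead c4), residual stub L3 `stub_compensatorEssUnbounded`: the LSW
compensator `L^A = ∫₀^∞ m(A_t − W_t) dt` (`m = starBubbleMass`, `A_t − W_t = Loewner.slidHull W A t`)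
must be essentially unbounded on the avoidance event. This file supplies the EXPLICIT DRIVER along
which the partial compensator diverges: the zero driving function, whose Loewner chain is the
vertical slit `(0, 2i√t]`, aimed at the lowest point `i y₀` of the hull `A` on the imaginary axis.

* `Loewner`'s equation for `W ≡ 0` is `ġ = 2/g`, solved by `g_t(a) = a (1 + 4t/a²)^{1/2}`
  (principal branch; `isSolution_zeroDriver`) as long as `1 + 4t/a²` stays in the slit plane:
  forever when `Re a ≠ 0` (`swallowingTime_zeroDriver_eq_top`), and up to `y²/4` for `a = iy`,
  where `g_t(iy) = i√(y² − 4t)` (`map_zeroDriver_I_mul`);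
* hence a `*`-hull `A ∋ i y₀` containing no `iy`, `0 < y < y₀`, is missed by the closed hull
  `K̂_T` of the zero driver whenever `4T < y₀²` (`disjoint_closedHull_zeroDriver`), the slid hull
  `A_T` is a `*`-hull containing `i√(y₀² − 4T)`, so `m(A_T) ≥ 1/(2(y₀² − 4T))` by the one-point
  bound `starBubbleMass_ge_of_mem` (`(Im z/|z|²)²/2` at `z = i√(y₀² − 4T)`), and integrating,
  **`∫_{(0,T]} m(A_t) dt ≥ (1/8) log (y₀²/(y₀² − 4T)) → ∞` as `4T ↑ y₀²`**
  (`lintegral_starBubbleMass_verticalSlit_ge`, registered).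

References: G. F. Lawler, *Conformally Invariant Processes in the Plane* (2005), Ch. 4 §4.1 (the
Loewner flow; the vertical slit example `g_t(z) = √(z² + 4t)`); G. F. Lawler, O. Schramm,
W. Werner, *Conformal restriction: the chordal case*, J. Amer. Math. Soc. 16 (2003), §5 (5.1), §8.
No named fact is used.
-/

noncomputable section

open MeasureTheory Filter Topology Set Metric
open scoped NNReal ENNReal
open Literature.Probability.RandomPlanarGeometry
open UpperHalfPlane (upperHalfPlaneSet)

namespace Summit.CriticalPhenomena.SAWScalingLimit.Theorems.SubseqIdentification.BoundaryAreaLaw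

open Loewner

/-! ### The explicit Loewner flow of the zero driving function -/

section ZeroDriver

/-- The Loewner vector field of the zero driving function is `2/z`. [folklore] -/
theorem vectorField_zeroDriver (t : ℝ) (z : ℂ) :
    vectorField (fun _ : ℝ≥0 ↦ (0 : ℝ)) t z = 2 / z := by
  rw [vectorField_apply, Complex.ofReal_zero, sub_zero]

/-- **The explicit flow of the zero driver.** For `a ≠ 0`, `g(t) = a (1 + 4t/a²)^{1/2}`
(principal branch) solves Loewner's equation `ġ = 2/g`, `g(0) = a`, of the zero driving function
on every time interval on which `1 + 4t/a²` stays in the slit plane `ℂ ∖ (−∞, 0]`.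
[cite: Lawler2005, Ch. 4 §4.1] -/
theorem isSolution_zeroDriver {a : ℂ} (ha : a ≠ 0) {T : WithTop ℝ≥0}
    (hT : ∀ t : ℝ, 0 ≤ t → (t.toNNReal : WithTop ℝ≥0) < T →
      1 + 4 * (t : ℂ) * a⁻¹ ^ 2 ∈ Complex.slitPlane) :
    IsSolution (fun _ : ℝ≥0 ↦ (0 : ℝ)) a
      (fun t : ℝ ↦ a * (1 + 4 * (t : ℂ) * a⁻¹ ^ 2) ^ (2⁻¹ : ℂ)) T := by
  refine ⟨by simp, fun t ht ↦ ?_, fun t ht0 htT ↦ ?_⟩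
  · have hu := hT t ht.1 ht.2
    set u : ℂ := 1 + 4 * (t : ℂ) * a⁻¹ ^ 2 with hu_def
    have hu0 : u ≠ 0 := Complex.slitPlane_ne_zero hu
    have hin : HasDerivAt (fun s : ℝ ↦ 1 + 4 * (s : ℂ) * a⁻¹ ^ 2) (4 * a⁻¹ ^ 2) t := by
      have h1 : HasDerivAt (fun s : ℝ ↦ (s : ℂ)) 1 t := Complex.ofRealCLM.hasDerivAt
      exact (((h1.const_mul (4 : ℂ)).mul_const (a⁻¹ ^ 2)).const_add 1).congr_deriv (by ring)
    have hout : HasDerivAt (fun z : ℂ ↦ z ^ (2⁻¹ : ℂ)) (2⁻¹ * u ^ ((2⁻¹ : ℂ) - 1)) u :=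
      (Complex.hasStrictDerivAt_cpow_const hu).hasDerivAt
    have hcomp := (hout.comp t hin).const_mul a
    refine hcomp.hasDerivWithinAt.congr_deriv ?_
    rw [vectorField_zeroDriver]
    have hs0 : u ^ (2⁻¹ : ℂ) ≠ 0 := by
      rw [Ne, Complex.cpow_eq_zero_iff]
      exact fun h ↦ hu0 h.1
    have hss : u ^ (2⁻¹ : ℂ) * u ^ (2⁻¹ : ℂ) = u := by
      rw [← sq, Complex.cpow_ofNat_inv_pow]
    have hsub : u ^ ((2⁻¹ : ℂ) - 1) = u ^ (2⁻¹ : ℂ) / u := by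
      rw [Complex.cpow_sub _ _ hu0, Complex.cpow_one]
    rw [hsub, eq_div_iff (mul_ne_zero ha hs0)]
    set s : ℂ := u ^ (2⁻¹ : ℂ) with hs_def
    have h1 : a * (2⁻¹ * (s / u) * (4 * a⁻¹ ^ 2)) * (a * s) = 2 * (a * a⁻¹) ^ 2 * (s * s / u) := by
      ring
    rw [h1, mul_inv_cancel₀ ha, hss, div_self hu0]
    ring
  · have hu := hT t ht0 htT
    have hu0 : (1 + 4 * (t : ℂ) * a⁻¹ ^ 2) ≠ 0 := Complex.slitPlane_ne_zero hu
    have hs0 : (1 + 4 * (t : ℂ) * a⁻¹ ^ 2) ^ (2⁻¹ : ℂ) ≠ 0 := by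
      rw [Ne, Complex.cpow_eq_zero_iff]
      exact fun h ↦ hu0 h.1
    simpa using mul_ne_zero ha hs0

/-- Off the imaginary axis, `1 + 4t/a²` is in the slit plane for all `t ≥ 0` (`a` in the closed
upper half-plane): for real `a` it is a real number `≥ 1`, otherwise its imaginary part
`−8t Re a Im a/|a|⁴` vanishes only at `t = 0`. [folklore] -/
theorem one_add_mem_slitPlane_of_re_ne_zero {a : ℂ} (ha : a.re ≠ 0) {t : ℝ} (ht : 0 ≤ t) :
    1 + 4 * (t : ℂ) * a⁻¹ ^ 2 ∈ Complex.slitPlane := by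
  rw [Complex.mem_slitPlane_iff]
  have hn : 0 < Complex.normSq a := Complex.normSq_pos.2 fun h ↦ ha (by simp [h])
  by_cases him : a.im = 0
  · left
    have hre : (1 + 4 * (t : ℂ) * a⁻¹ ^ 2).re = 1 + 4 * t * (a.re / Complex.normSq a) ^ 2 := by
      simp only [Complex.add_re, Complex.one_re, Complex.mul_re, Complex.mul_im, Complex.re_ofNat,
        Complex.im_ofNat, Complex.ofReal_re, Complex.ofReal_im, sq, Complex.inv_re, Complex.inv_im,
        him, neg_zero, zero_div]
      ring
    rw [hre]
    positivity
  · rcases ht.eq_or_lt with rfl | ht'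
    · left; simp
    · right
      have hime : (1 + 4 * (t : ℂ) * a⁻¹ ^ 2).im =
          4 * t * (2 * (a.re / Complex.normSq a) * (-a.im / Complex.normSq a)) := by
        simp only [Complex.add_im, Complex.one_im, Complex.mul_re, Complex.mul_im, Complex.re_ofNat,
          Complex.im_ofNat, Complex.ofReal_re, Complex.ofReal_im, sq, Complex.inv_re, Complex.inv_im]
        ring
      rw [hime]
      have h1 : a.re / Complex.normSq a ≠ 0 := div_ne_zero ha hn.ne'
      have h2 : -a.im / Complex.normSq a ≠ 0 := div_ne_zero (neg_ne_zero.2 him) hn.ne'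
      positivity

/-- On the imaginary axis, `1 + 4t/(iy)² = 1 − 4t/y²`, a real number. [folklore] -/
theorem one_add_I_mul_eq {y : ℝ} (hy : y ≠ 0) (t : ℝ) :
    1 + 4 * (t : ℂ) * ((Complex.I * y)⁻¹) ^ 2 = ((1 - 4 * t / y ^ 2 : ℝ) : ℂ) := by
  have hy' : (y : ℂ) ≠ 0 := Complex.ofReal_ne_zero.2 hy
  rw [inv_pow, mul_pow, Complex.I_sq]
  push_cast
  field_simp
  ring

/-- **Points off the imaginary axis are never swallowed by the vertical slit**: for `Re a ≠ 0`
the solution `a(1 + 4t/a²)^{1/2}` of the zero driver is global, `T_a = ∞`.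
[cite: Lawler2005, Ch. 4 §4.1] -/
theorem swallowingTime_zeroDriver_eq_top {a : ℂ} (ha : a.re ≠ 0) :
    swallowingTime (fun _ : ℝ≥0 ↦ (0 : ℝ)) a = ⊤ := by
  have ha0 : a ≠ 0 := fun h ↦ ha (by simp [h])
  exact top_le_iff.1 (isSolution_zeroDriver (T := ⊤) ha0
    (fun t ht _ ↦ one_add_mem_slitPlane_of_re_ne_zero ha ht)).le_swallowingTime

/-- **The flow of the zero driver on the imaginary axis**: for `y > 0`, `t ↦ iy(1 − 4t/y²)^{1/2}`
solves the equation up to time `y²/4`. [cite: Lawler2005, Ch. 4 §4.1] -/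
theorem isSolution_zeroDriver_I_mul {y : ℝ} (hy : 0 < y) :
    IsSolution (fun _ : ℝ≥0 ↦ (0 : ℝ)) (Complex.I * y)
      (fun t : ℝ ↦ Complex.I * y * (1 + 4 * (t : ℂ) * (Complex.I * y)⁻¹ ^ 2) ^ (2⁻¹ : ℂ))
      ((y ^ 2 / 4).toNNReal : ℝ≥0) := by
  have hIy : Complex.I * y ≠ 0 := mul_ne_zero Complex.I_ne_zero (Complex.ofReal_ne_zero.2 hy.ne')
  refine isSolution_zeroDriver hIy fun t _ htT ↦ ?_
  rw [one_add_I_mul_eq hy.ne', Complex.ofReal_mem_slitPlane]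
  have ht : t < y ^ 2 / 4 := by
    have := WithTop.coe_lt_coe.1 htT
    rwa [Real.toNNReal_lt_toNNReal_iff (by positivity)] at this
  rw [sub_pos, div_lt_one (by positivity)]
  linarith

/-- A point `iy`, `y > 0`, flows for the zero driver at least until `y²/4`:
`y²/4 ≤ T_{iy}`. [cite: Lawler2005, Ch. 4 §4.1] -/
theorem le_swallowingTime_zeroDriver_I_mul {y : ℝ} (hy : 0 < y) :
    (((y ^ 2 / 4).toNNReal : ℝ≥0) : WithTop ℝ≥0) ≤ swallowingTime (fun _ : ℝ≥0 ↦ (0 : ℝ)) (Complex.I * y) :=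
  (isSolution_zeroDriver_I_mul hy).le_swallowingTime

/-- **`g_t(iy) = i√(y² − 4t)` for the zero driver**, `4t < y²`. [cite: Lawler2005, Ch. 4 §4.1] -/
theorem map_zeroDriver_I_mul {y : ℝ} (hy : 0 < y) {t : ℝ≥0} (ht : 4 * (t : ℝ) < y ^ 2) :
    map (fun _ : ℝ≥0 ↦ (0 : ℝ)) t (Complex.I * y) = Complex.I * Real.sqrt (y ^ 2 - 4 * t) := by
  have htT : (t : WithTop ℝ≥0) < (((y ^ 2 / 4).toNNReal : ℝ≥0) : WithTop ℝ≥0) := by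
    rw [WithTop.coe_lt_coe, ← Real.toNNReal_coe (r := t), Real.toNNReal_lt_toNNReal_iff (by positivity)]
    linarith
  rw [map_eq_of_isSolution continuous_const (isSolution_zeroDriver_I_mul hy) htT]
  have h1 : 0 ≤ 1 - 4 * (t : ℝ) / y ^ 2 := by
    rw [sub_nonneg, div_le_one (by positivity)]; linarith
  rw [one_add_I_mul_eq hy.ne', show (2⁻¹ : ℂ) = ((2⁻¹ : ℝ) : ℂ) by push_cast; rfl,
    ← Complex.ofReal_cpow h1, mul_assoc, ← Complex.ofReal_mul]
  congr 2
  rw [← one_div, ← Real.sqrt_eq_rpow]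
  calc y * Real.sqrt (1 - 4 * (t : ℝ) / y ^ 2)
      = Real.sqrt (y ^ 2) * Real.sqrt (1 - 4 * (t : ℝ) / y ^ 2) := by rw [Real.sqrt_sq hy.le]
    _ = Real.sqrt (y ^ 2 * (1 - 4 * (t : ℝ) / y ^ 2)) := (Real.sqrt_mul (sq_nonneg y) _).symm
    _ = Real.sqrt (y ^ 2 - 4 * (t : ℝ)) := by
        congr 1
        field_simp

end ZeroDriver

/-! ### The vertical slit misses the hull, and the compensator diverges -/

section Slit

variable {A : Set ℂ} {y₀ : ℝ}

/-- **The closed hull of the vertical slit misses `A`.** If the `*`-hull `A` contains no point `iy`,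
`0 < y < y₀`, then every point of `A` is still flowing at every time `T` with `4T < y₀²`: points off
the imaginary axis are never swallowed, and a point `iy ∈ A` has `y ≥ y₀`, so it lives until
`y²/4 > T`. [cite: Lawler2005, Ch. 4 §4.1] -/
theorem disjoint_closedHull_zeroDriver (hA : IsStarHull A) (hy₀ : 0 < y₀)
    (hgap : ∀ y : ℝ, 0 < y → y < y₀ → Complex.I * y ∉ A) {T : ℝ≥0} (hT : 4 * (T : ℝ) < y₀ ^ 2) :
    Disjoint (closedHull (fun _ : ℝ≥0 ↦ (0 : ℝ)) T) A := by
  refine Set.disjoint_left.2 fun a haK haA ↦ ?_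
  obtain ⟨him, hle⟩ := haK
  have ha0 : a ≠ 0 := fun h ↦ hA.zero_notMem (h ▸ haA)
  refine hle.not_gt ?_
  by_cases hre : a.re = 0
  · -- `a = i y` with `y ≥ y₀`
    have hy : 0 < a.im := by
      rcases him.lt_or_eq with h | h
      · exact h
      · exact absurd (Complex.ext (by simp [hre]) (by simp [← h])) ha0
    have ha : a = Complex.I * a.im := Complex.ext (by simp [hre]) (by simp)
    have hyy : y₀ ≤ a.im := by
      by_contra h
      exact hgap a.im hy (not_le.1 h) (ha ▸ haA)
    rw [ha]
    refine lt_of_lt_of_le ?_ (le_swallowingTime_zeroDriver_I_mul hy)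
    rw [WithTop.coe_lt_coe, ← Real.toNNReal_coe (r := T), Real.toNNReal_lt_toNNReal_iff (by positivity)]
    nlinarith [mul_self_le_mul_self hy₀.le hyy]
  · rw [swallowingTime_zeroDriver_eq_top hre]
    exact WithTop.coe_lt_top T

/-- **The one-point bound along the slit**: for `A ∈ 𝒬*` with `i y₀ ∈ A` and no `iy ∈ A`,
`0 < y < y₀`, and `4t < y₀²`, the slid hull `A_t` of the zero driver is a `*`-hull containing
`i√(y₀² − 4t)`, so `m(A_t) ≥ 1/(2(y₀² − 4t))`.
[cite: LawlerSchrammWerner2003Restriction, §5 eq. (5.1)] -/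
theorem inv_le_starBubbleMass_slidHull_zeroDriver (hA : IsStarHull A) (hy₀ : 0 < y₀)
    (hmem : Complex.I * y₀ ∈ A) (hgap : ∀ y : ℝ, 0 < y → y < y₀ → Complex.I * y ∉ A) {t : ℝ≥0}
    (ht : 4 * (t : ℝ) < y₀ ^ 2) :
    1 / (2 * (y₀ ^ 2 - 4 * t)) ≤ starBubbleMass (slidHull (fun _ : ℝ≥0 ↦ (0 : ℝ)) A t) := by
  have hdisj := disjoint_closedHull_zeroDriver hA hy₀ hgap ht
  have hstar : IsStarHull (slidHull (fun _ : ℝ≥0 ↦ (0 : ℝ)) A t) :=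
    Loewner.isStarHull_slidHull_of_disjoint continuous_const hA hdisj
  set r : ℝ := y₀ ^ 2 - 4 * t with hr
  have hrpos : 0 < r := by rw [hr]; linarith
  have hz : Complex.I * Real.sqrt r ∈ slidHull (fun _ : ℝ≥0 ↦ (0 : ℝ)) A t := by
    refine mem_slidHull_iff.2 ⟨Complex.I * y₀, hmem, ?_⟩
    rw [map_zeroDriver_I_mul hy₀ ht, Complex.ofReal_zero, sub_zero]
  have hzi : 0 < (Complex.I * Real.sqrt r).im := by simpa using Real.sqrt_pos.2 hrpos
  have key := starBubbleMass_ge_of_mem _ hstar _ hz hzi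
  have him : (Complex.I * Real.sqrt r).im = Real.sqrt r := by simp
  have hns : Complex.normSq (Complex.I * Real.sqrt r) = r := by
    rw [Complex.normSq_mul, Complex.normSq_I, one_mul, Complex.normSq_ofReal,
      Real.mul_self_sqrt hrpos.le]
  rw [him, hns] at key
  have hsq : (Real.sqrt r / r) ^ 2 / 2 = 1 / (2 * r) := by
    rw [div_pow, Real.sq_sqrt hrpos.le]
    field_simp
  linarith [hsq ▸ key]

/-- **DIVERGENCE OF THE COMPENSATOR ALONG THE VERTICAL SLIT.** For `A ∈ 𝒬*` with `i y₀ ∈ A` and no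
`iy ∈ A`, `0 < y < y₀`, and `4T < y₀²`:
`∫_{(0,T]} m(A_t) dt ≥ ∫₀^T dt/(2(y₀² − 4t)) = (1/8) log (y₀²/(y₀² − 4T))`, which tends to `∞` as
`4T ↑ y₀²`. [cite: LawlerSchrammWerner2003Restriction, §5 eq. (5.1)] [cite: Lawler2005, Ch. 4 §4.1] -/
theorem log_div_le_lintegral_starBubbleMass_zeroDriver (hA : IsStarHull A) (hy₀ : 0 < y₀)
    (hmem : Complex.I * y₀ ∈ A) (hgap : ∀ y : ℝ, 0 < y → y < y₀ → Complex.I * y ∉ A) {T : ℝ≥0}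
    (hT : 4 * (T : ℝ) < y₀ ^ 2) :
    ENNReal.ofReal (Real.log (y₀ ^ 2 / (y₀ ^ 2 - 4 * T)) / 8) ≤
      ∫⁻ x in Ioc (0 : ℝ) T,
        ENNReal.ofReal (starBubbleMass (slidHull (fun _ : ℝ≥0 ↦ (0 : ℝ)) A x.toNNReal)) := by
  set f : ℝ → ℝ := fun x ↦ 1 / (2 * (y₀ ^ 2 - 4 * x)) with hf
  set F : ℝ → ℝ := fun x ↦ -(Real.log (y₀ ^ 2 - 4 * x)) / 8 with hF
  have hT0 : (0 : ℝ) ≤ T := T.coe_nonneg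
  have hpos : ∀ x ∈ Icc (0 : ℝ) T, 0 < y₀ ^ 2 - 4 * x := fun x hx ↦ by linarith [hx.2]
  -- FTC: `∫₀^T f = F T − F 0`
  have hderiv : ∀ x ∈ uIcc (0 : ℝ) T, HasDerivAt F (f x) x := by
    intro x hx
    rw [uIcc_of_le hT0] at hx
    have h1 : HasDerivAt (fun x : ℝ ↦ y₀ ^ 2 - 4 * x) (-4) x := by
      simpa using ((hasDerivAt_id x).const_mul (4 : ℝ)).const_sub (y₀ ^ 2)
    have h2 := ((h1.log (hpos x hx).ne').neg).div_const 8
    refine h2.congr_deriv ?_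
    rw [hf]
    field_simp [(hpos x hx).ne']
    ring
  have hfc : ContinuousOn f (Icc (0 : ℝ) T) := by
    refine continuousOn_const.div (continuousOn_const.mul (continuousOn_const.sub
      (continuousOn_const.mul continuousOn_id))) fun x hx ↦ ?_
    exact mul_ne_zero two_ne_zero (hpos x hx).ne'
  have hfi : IntervalIntegrable f volume 0 T := hfc.intervalIntegrable_of_Icc hT0
  have hFTC : ∫ x in (0 : ℝ)..T, f x = Real.log (y₀ ^ 2 / (y₀ ^ 2 - 4 * T)) / 8 := by
    rw [intervalIntegral.integral_eq_sub_of_hasDerivAt hderiv hfi, hF]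
    simp only [mul_zero, sub_zero]
    rw [Real.log_div (by positivity) (hpos T ⟨hT0, le_rfl⟩).ne']
    ring
  -- pointwise bound on `(0, T]`
  have hpt : ∀ x ∈ Ioc (0 : ℝ) T,
      ENNReal.ofReal (f x) ≤
        ENNReal.ofReal (starBubbleMass (slidHull (fun _ : ℝ≥0 ↦ (0 : ℝ)) A x.toNNReal)) := by
    intro x hx
    refine ENNReal.ofReal_le_ofReal ?_
    have hx' : ((x.toNNReal : ℝ≥0) : ℝ) = x := Real.coe_toNNReal _ hx.1.le
    have := inv_le_starBubbleMass_slidHull_zeroDriver hA hy₀ hmem hgap (t := x.toNNReal)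
      (by rw [hx']; linarith [hx.2])
    rwa [hx'] at this
  have hnn : 0 ≤ᵐ[volume.restrict (Ioc (0 : ℝ) T)] f := by
    filter_upwards [ae_restrict_mem measurableSet_Ioc] with x hx
    exact (one_div_pos.2 (mul_pos two_pos (hpos x (Ioc_subset_Icc_self hx)))).le
  calc ENNReal.ofReal (Real.log (y₀ ^ 2 / (y₀ ^ 2 - 4 * T)) / 8)
      = ENNReal.ofReal (∫ x in (0 : ℝ)..T, f x) := by rw [hFTC]
    _ = ∫⁻ x in Ioc (0 : ℝ) T, ENNReal.ofReal (f x) := by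
        rw [intervalIntegral.integral_of_le hT0,
          ofReal_integral_eq_lintegral_ofReal
            ((intervalIntegrable_iff_integrableOn_Ioc_of_le hT0).1 hfi) hnn]
    _ ≤ ∫⁻ x in Ioc (0 : ℝ) T,
          ENNReal.ofReal (starBubbleMass (slidHull (fun _ : ℝ≥0 ↦ (0 : ℝ)) A x.toNNReal)) :=
        setLIntegral_mono' measurableSet_Ioc hpt

end Slit

/-! ### Registered form -/

/-- **Registered helper `lintegral_starBubbleMass_verticalSlit_ge`** (closed form of
`disjoint_closedHull_zeroDriver` and `log_div_le_lintegral_starBubbleMass_zeroDriver`): for every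
`A ∈ 𝒬*`, every `y₀ > 0` with `i y₀ ∈ A` and `iy ∉ A` for `0 < y < y₀`, and every `T` with
`4T < y₀²`, the closed hull of the zero driving function (the vertical slit `(0, 2i√T]`) misses
`A`, and `(1/8) log (y₀²/(y₀² − 4T)) ≤ ∫_{(0,T]} m(A_t) dt` — the partial LSW compensator of `A`
along the vertical slit diverges as the slit approaches `i y₀`.
[cite: LawlerSchrammWerner2003Restriction, §5 eq. (5.1)] [cite: Lawler2005, Ch. 4 §4.1] -/
theorem lintegral_starBubbleMass_verticalSlit_ge :
    ∀ (A : Set ℂ), IsStarHull A → ∀ (y₀ : ℝ), 0 < y₀ → Complex.I * y₀ ∈ A →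
      (∀ y : ℝ, 0 < y → y < y₀ → Complex.I * y ∉ A) → ∀ (T : ℝ≥0), 4 * (T : ℝ) < y₀ ^ 2 →
      Disjoint (Loewner.closedHull (fun _ : ℝ≥0 => (0 : ℝ)) T) A ∧
      ENNReal.ofReal (Real.log (y₀ ^ 2 / (y₀ ^ 2 - 4 * T)) / 8) ≤
        ∫⁻ x in Set.Ioc (0 : ℝ) T, ENNReal.ofReal (starBubbleMass (Loewner.slidHull (fun _ : ℝ≥0 => (0 : ℝ)) A x.toNNReal)) :=
  fun _ hA _ hy₀ hmem hgap _ hT ↦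
    ⟨disjoint_closedHull_zeroDriver hA hy₀ hgap hT,
      log_div_le_lintegral_starBubbleMass_zeroDriver hA hy₀ hmem hgap hT⟩

end Summit.CriticalPhenomena.SAWScalingLimit.Theorems.SubseqIdentification.BoundaryAreaLaw

end
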